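import Summits.QuantumAdvantage.AdviceFreeQNC0.RingSymmetry
import HarnessLib

/-!
# Cell qa-qnc0 (rung F-Q1, route `RingFrame`, crux α `RingToElim`): rotations of the ring and the
# rotation invariance of the ring relation `RingHLF.Rel`

Groundwork for planner qa-qnc0-p2's ROUND-7 ask R7-b (PROPOSITION S / `SymmetrizationLemma`,
`LowDegLeaderElection`, `ERHIffRingHard`; `HOME/qa-qnc0-p2/ROUND-7.md` §2, `line/Sketch7.lean` §1b),
continuing `RingSymmetry.lean` (which has `rot`, `shift`, `rot_injective`, `card_fires_rot`):

* algebra of the cyclic rotations `rot k x = x ∘ shift k` (`rot_rot`, `rot_mod`, `rot_zero`,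
  `rot_mul_self`, `shift_shift`), bijectivity and the counting lemmas `card_filter_rot` /
  `card_filter_shift` (a rotation / shift does not change the number of patterns / positions
  satisfying a predicate);
* the ring structure commutes with shifts (`shift_nxt`, `shift_prv`), hence the ring kernel, the
  edge count, `wtAnd`, `dot2` and the sign bit are rotation invariant, and
  **`rel_rot : Rel (rot k x) (rot k z) ↔ Rel x z`** — the HLF game of the cycle `C_n` is invariant
  under the rotation `b ↦ b + k` (the symmetry that PROPOSITION S exploits).

Elementary (folklore-level) bookkeeping; no bearing on α's truth.  WHAT THIS IS NOT: not the
symmetrization lemma itself (next files); separation NOT moved.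
-/

noncomputable section

open scoped Classical

namespace Summit.QuantumAdvantage.AdviceFreeQNC0

open Finset
open Literature.Computability.QuantumComplexity Literature.Computability.QuantumComplexity.RingHLF
open Literature.Computability.MetaComplexity Literature.Computability.MetaComplexity.Smolensky

namespace RingSymmetry

variable {n : ℕ}

/-! ### Algebra of rotations -/

/-- Two shifts agree iff the shift amounts agree modulo `n`. -/
theorem shift_eq_shift_of_mod_eq {k k' : ℕ} (h : k % n = k' % n) (b : Fin n) :
    shift n k b = shift n k' b := by
  apply Fin.ext
  simp only [shift]
  rw [Nat.add_mod, h, ← Nat.add_mod]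

/-- Rotations depend only on the amount modulo `n`. -/
theorem rot_eq_rot_of_mod_eq {k k' : ℕ} (h : k % n = k' % n) (x : Fin n → Bool) :
    rot k x = rot k' x := by
  funext b
  simp only [rot_eq_comp, Function.comp, shift_eq_shift_of_mod_eq h]

/-- `rot (k % n) = rot k`. -/
theorem rot_mod (k : ℕ) (x : Fin n → Bool) : rot (k % n) x = rot k x :=
  rot_eq_rot_of_mod_eq (Nat.mod_mod _ _) x

/-- Composition of shifts adds the amounts. -/
theorem shift_shift (a b : ℕ) (i : Fin n) : shift n a (shift n b i) = shift n (b + a) i := by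
  apply Fin.ext
  simp only [shift]
  rw [Nat.mod_add_mod, Nat.add_assoc]

/-- Composition of rotations adds the amounts: `rot a (rot b x) = rot (a + b) x`. -/
theorem rot_rot (a b : ℕ) (x : Fin n → Bool) : rot a (rot b x) = rot (a + b) x := by
  funext i
  simp only [rot_eq_comp, Function.comp]
  congr 1
  apply Fin.ext
  simp only [shift]
  rw [Nat.mod_add_mod, Nat.add_assoc]

/-- `rot 0` is the identity. -/
theorem rot_zero (x : Fin n → Bool) : rot 0 x = x := by
  funext i
  simp only [rot_eq_comp, Function.comp, shift, Nat.add_zero, Nat.mod_eq_of_lt i.isLt]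

/-- Rotating by a multiple of `n` is the identity. -/
theorem rot_mul_self (q : ℕ) (x : Fin n → Bool) : rot (n * q) x = x := by
  rw [← rot_mod, Nat.mul_mod_right, rot_zero]

/-! ### Counting under bijections of a finite type -/

/-- Precomposing a predicate with a bijection of a finite type does not change the count. -/
theorem card_filter_comp_of_bijective {α : Type*} [Fintype α] (φ : α → α)
    (hφ : Function.Bijective φ) (P : α → Prop) [DecidablePred P]
    [DecidablePred fun a => P (φ a)] :
    (univ.filter fun a => P (φ a)).card = (univ.filter P).card := by
  refine card_bij (fun a _ => φ a) (fun a ha => ?_) (fun a _ b _ h => hφ.1 h) (fun b hb => ?_)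
  · rw [mem_filter] at ha ⊢; exact ⟨mem_univ _, ha.2⟩
  · obtain ⟨a, rfl⟩ := hφ.2 b
    rw [mem_filter] at hb
    exact ⟨a, mem_filter.2 ⟨mem_univ _, hb.2⟩, rfl⟩

/-- The shift is a bijection of `Fin n`. -/
theorem shift_bijective (k : ℕ) : Function.Bijective (shift n k) :=
  ⟨shift_injective k, Finite.surjective_of_injective (shift_injective k)⟩

/-- Rotation is a bijection of the patterns. -/
theorem rot_bijective (k : ℕ) : Function.Bijective (rot (n := n) k) :=
  ⟨rot_injective k, Finite.surjective_of_injective (rot_injective k)⟩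

/-- Counting patterns through a rotation. -/
theorem card_filter_rot (k : ℕ) (P : (Fin n → Bool) → Prop) [DecidablePred P]
    [DecidablePred fun x : Fin n → Bool => P (rot k x)] :
    (univ.filter fun x : Fin n → Bool => P (rot k x)).card = (univ.filter P).card :=
  card_filter_comp_of_bijective _ (rot_bijective k) P

/-- Counting positions through a shift. -/
theorem card_filter_shift (k : ℕ) (P : Fin n → Prop) [DecidablePred P]
    [DecidablePred fun b : Fin n => P (shift n k b)] :
    (univ.filter fun b : Fin n => P (shift n k b)).card = (univ.filter P).card :=
  card_filter_comp_of_bijective _ (shift_bijective k) P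

/-! ### The ring structure commutes with shifts -/

/-- `shift k (nxt b) = nxt (shift k b)`. -/
theorem shift_nxt (k : ℕ) (b : Fin n) : shift n k (nxt b) = nxt (shift n k b) := by
  apply Fin.ext
  simp only [shift, nxt]
  rw [Nat.mod_add_mod, Nat.mod_add_mod, Nat.add_right_comm]

/-- `shift k (prv b) = prv (shift k b)`. -/
theorem shift_prv (k : ℕ) (b : Fin n) : shift n k (prv b) = prv (shift n k b) := by
  apply Fin.ext
  simp only [shift, prv]
  have hn : 0 < n := b.pos
  rw [Nat.mod_add_mod]
  have e1 : b.val + n - 1 + k = b.val + k + (n - 1) := by omega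
  have e2 : (b.val + k) % n + n - 1 = (b.val + k) % n + (n - 1) := by omega
  rw [e1, e2, Nat.add_mod ((b.val + k) % n), Nat.mod_mod, ← Nat.add_mod]

/-- A rotated pattern read at a position is the pattern read at the shifted position. -/
theorem rot_apply (k : ℕ) (x : Fin n → Bool) (b : Fin n) : rot k x b = x (shift n k b) := rfl

/-- The ring kernel is rotation invariant: `v ∈ K(x) ↔ rot v ∈ K(rot x)`. -/
theorem inKernel_rot (k : ℕ) (x v : Fin n → Bool) :
    InKernel (rot k x) (rot k v) ↔ InKernel x v := by
  unfold InKernel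
  simp only [rot_apply, shift_nxt, shift_prv]
  constructor
  · intro h b
    obtain ⟨b', rfl⟩ := (shift_bijective (n := n) k).2 b
    exact h b'
  · intro h b
    exact h (shift n k b)

/-- `edgesIn` is rotation invariant. -/
theorem edgesIn_rot (k : ℕ) (v : Fin n → Bool) : edgesIn (rot k v) = edgesIn v := by
  unfold edgesIn
  simp only [rot_apply, shift_nxt]
  exact card_filter_shift k (fun b => v b = true ∧ v (nxt b) = true)

/-- `wtAnd` is rotation invariant. -/
theorem wtAnd_rot (k : ℕ) (x v : Fin n → Bool) : wtAnd (rot k x) (rot k v) = wtAnd x v := by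
  unfold wtAnd
  simp only [rot_apply]
  exact card_filter_shift k (fun b => x b = true ∧ v b = true)

/-- `dot2` is rotation invariant. -/
theorem dot2_rot (k : ℕ) (v z : Fin n → Bool) : dot2 (rot k v) (rot k z) = dot2 v z := by
  unfold dot2
  simp only [rot_apply]
  rw [card_filter_shift k (fun b => v b = true ∧ z b = true)]

/-- The sign bit is rotation invariant. -/
theorem signBit_rot (k : ℕ) (x v : Fin n → Bool) : signBit (rot k x) (rot k v) = signBit x v := by
  unfold signBit
  rw [edgesIn_rot, wtAnd_rot]

/-- **The ring relation is rotation invariant**: `Rel (rot k x) (rot k z) ↔ Rel x z`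
(the cycle `C_n` and its HLF game are invariant under the rotation `b ↦ b + 1`). -/
theorem rel_rot (k : ℕ) (x z : Fin n → Bool) :
    RingHLF.Rel (rot k x) (rot k z) ↔ RingHLF.Rel x z := by
  unfold RingHLF.Rel
  constructor
  · intro h v hv
    have := h (rot k v) ((inKernel_rot k x v).2 hv)
    rwa [dot2_rot, signBit_rot] at this
  · intro h v hv
    obtain ⟨v', rfl⟩ := (rot_bijective (n := n) k).2 v
    rw [dot2_rot, signBit_rot]
    exact h v' ((inKernel_rot k x v').1 hv)

end RingSymmetry

end Summit.QuantumAdvantage.AdviceFreeQNC0
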